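import Summits.AtomisticToContinuum.Crystallization.Theorems.ExcessDecayLiouvillePhononStabilityDefs

/-!
# `PhononStability` (stmt-AtomisticToContinuum-9333), line `contragredient-window-collapse`: stub `stub_labels`

Reduction S1a of the line (the GEOMETRIC half of the pull-back, `LabelModel`): an admissible datum `(t, A)`
(`Adm₀ A`: `‖A − 0.97·R‖ ≤ 1/40` for a linear isometry `R`; `Inner₀ t A`: `‖t 1 − t 0 − A·innerRef‖ ≤ 1/40`) has

* all stretches in the window, `0.945‖x‖ ≤ ‖Ax‖ ≤ 0.995‖x‖` (`CellWindow A`, triangle inequality around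
  `0.97·Rx`), hence `A` is invertible (injective endomorphism of `ℝ³`);
* a contragredient `B = A⁻ᵀ` (`Contragredient A B`: `⟪Ax, By⟫ = ⟪x, y⟫`), namely the adjoint of `A⁻¹`;
* a pulled-back shift error `δ = A⁻¹(t 1 − t 0) − innerRef` with `‖Aδ‖ ≤ 1/40` (`ShiftWindow A δ`, this IS `Inner₀`);
* and the label map `(m, n) ↦ t 0 + A·refPos δ (m, n) = t m + A·latVec n` is a bijection `Fin 2 × ℤ³ → Sites₀ t A`:
  its range is the site set by definition of `Λ₀ = latVec ℤ³`; it is injective on each sublattice because `A` and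
  `n ↦ latVec n` are injective (coordinates), and the two sublattices cannot collide because a collision forces
  `innerRef + δ ∈ latVec ℤ³`, whereas `dist(innerRef, latVec ℤ³) ≥ 1` (in coordinates
  `12‖innerRef − latVec d‖² = 3(1 − 2d₀ − d₁)² + (1 − 3d₁)² + 8(1 − 2d₂)² ≥ 12` over `ℤ`) and `‖δ‖ ≤ 5/189`.

All `[folklore]`.
-/

noncomputable section

open scoped BigOperators Classical InnerProductSpace
open Filter Set Function
open Literature.MathematicalPhysics.StatisticalMechanics
open Summit.AtomisticToContinuum.Crystallization.Theses.ExcessDecayLiouville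
open Summit.AtomisticToContinuum.Crystallization.Theorems.PhononStabilityNegative
open Summit.AtomisticToContinuum.Crystallization.Theorems.PhononStabilityCWC

namespace Summit.AtomisticToContinuum.Crystallization.Theorems.PhononStabilityCWC.LabelsStub

/-! ## The window bounds of an admissible cell -/

/-- `Adm₀ A` puts all stretches of `A` in `[0.945, 0.995]`: `‖Ax‖ = ‖0.97·Rx + (A − 0.97R)x‖` with
`‖0.97·Rx‖ = 0.97‖x‖` and `‖(A − 0.97R)x‖ ≤ ‖x‖/40`. [folklore] -/
theorem cellWindow_of_adm₀ {A : EuclideanSpace ℝ (Fin 3) →L[ℝ] EuclideanSpace ℝ (Fin 3)} (hA : Adm₀ A) :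
    CellWindow A := by
  obtain ⟨R, hR⟩ := hA
  intro x
  set D : EuclideanSpace ℝ (Fin 3) →L[ℝ] EuclideanSpace ℝ (Fin 3) :=
    A - (97 / 100 : ℝ) • (R.toContinuousLinearEquiv : EuclideanSpace ℝ (Fin 3) →L[ℝ] EuclideanSpace ℝ (Fin 3))
    with hD
  have h1 : ‖D x‖ ≤ 1 / 40 * ‖x‖ := (D.le_opNorm x).trans (mul_le_mul_of_nonneg_right hR (norm_nonneg x))
  have h2 : A x = D x + (97 / 100 : ℝ) • R x := by
    rw [hD]
    simp
  have h3 : ‖(97 / 100 : ℝ) • R x‖ = 97 / 100 * ‖x‖ := by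
    rw [norm_smul, LinearIsometryEquiv.norm_map, Real.norm_of_nonneg (by norm_num)]
  have h4 : ‖A x‖ ≤ ‖D x‖ + ‖(97 / 100 : ℝ) • R x‖ := by rw [h2]; exact norm_add_le _ _
  have h5 : ‖(97 / 100 : ℝ) • R x‖ ≤ ‖A x‖ + ‖D x‖ := by
    have : (97 / 100 : ℝ) • R x = A x - D x := by rw [h2]; abel
    rw [this]
    exact norm_sub_le _ _
  constructor <;> linarith

/-- A cell in the window is injective (lower stretch `0.945 > 0`); copy of the line's Basics lemma. [folklore] -/
private theorem injective_of_cellWindow {A : EuclideanSpace ℝ (Fin 3) →L[ℝ] EuclideanSpace ℝ (Fin 3)}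
    (hW : CellWindow A) : Function.Injective A := by
  intro x x' h
  have h1 := (hW (x - x')).1
  rw [map_sub, h, sub_self, norm_zero] at h1
  have h2 : ‖x - x'‖ ≤ 0 := by linarith [norm_nonneg (x - x')]
  exact sub_eq_zero.mp (norm_le_zero_iff.mp h2)

/-- **Shift bound** `‖δ‖ ≤ 5/189` from `‖Aδ‖ ≤ 1/40` and the lower stretch `189/200`; copy of the line's Basics
lemma. [folklore] -/
private theorem norm_shift_le {A : EuclideanSpace ℝ (Fin 3) →L[ℝ] EuclideanSpace ℝ (Fin 3)}
    {δ : EuclideanSpace ℝ (Fin 3)} (hW : CellWindow A) (hδ : ShiftWindow A δ) : ‖δ‖ ≤ 5 / 189 := by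
  have h1 := (hW δ).1
  unfold ShiftWindow at hδ
  linarith

/-- A window cell has a two-sided continuous linear inverse (injective endomorphism of `ℝ³`). [folklore] -/
theorem exists_inverse_of_cellWindow {A : EuclideanSpace ℝ (Fin 3) →L[ℝ] EuclideanSpace ℝ (Fin 3)}
    (hW : CellWindow A) :
    ∃ Ai : EuclideanSpace ℝ (Fin 3) →L[ℝ] EuclideanSpace ℝ (Fin 3), (∀ x, Ai (A x) = x) ∧ ∀ y, A (Ai y) = y := by
  have hinj : Function.Injective (A : EuclideanSpace ℝ (Fin 3) →ₗ[ℝ] EuclideanSpace ℝ (Fin 3)) :=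
    injective_of_cellWindow hW
  set L : EuclideanSpace ℝ (Fin 3) ≃ₗ[ℝ] EuclideanSpace ℝ (Fin 3) :=
    LinearEquiv.ofInjectiveEndo (A : EuclideanSpace ℝ (Fin 3) →ₗ[ℝ] EuclideanSpace ℝ (Fin 3)) hinj
  refine ⟨LinearMap.toContinuousLinearMap (L.symm : EuclideanSpace ℝ (Fin 3) →ₗ[ℝ] EuclideanSpace ℝ (Fin 3)),
    fun x => ?_, fun y => ?_⟩
  · exact L.symm_apply_apply x
  · exact L.apply_symm_apply y

/-! ## Coordinates of the reference two-lattice -/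

/-- Coordinates of `latVec n = (n₀ + n₁/2, n₁√3/2, 2n₂√(2/3))`. [folklore] -/
theorem latVec_apply (n : Fin 3 → ℤ) :
    latVec n 0 = n 0 + n 1 / 2 ∧ latVec n 1 = n 1 * √3 / 2 ∧ latVec n 2 = n 2 * (2 * √(2 / 3)) := by
  refine ⟨?_, ?_, ?_⟩ <;>
    simp [latVec, genU, genV, genC, triangularVec₁, triangularVec₂, layerNormal] <;> ring

/-- Coordinates of `innerRef = (1/2, √3/6, √(2/3))`. [folklore] -/
theorem innerRef_apply : innerRef 0 = 1 / 2 ∧ innerRef 1 = √3 / 6 ∧ innerRef 2 = √(2 / 3) := by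
  refine ⟨?_, ?_, ?_⟩ <;> simp [innerRef, barlowOffset, layerNormal]

/-- `n ↦ latVec n` is injective (triangular coordinates). [folklore] -/
theorem latVec_injective : Function.Injective latVec := by
  intro n n' h
  obtain ⟨a0, a1, a2⟩ := latVec_apply n
  obtain ⟨b0, b1, b2⟩ := latVec_apply n'
  have h0 := congrArg (fun v : EuclideanSpace ℝ (Fin 3) => v 0) h
  have h1 := congrArg (fun v : EuclideanSpace ℝ (Fin 3) => v 1) h
  have h2 := congrArg (fun v : EuclideanSpace ℝ (Fin 3) => v 2) h
  simp only at h0 h1 h2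
  rw [a0, b0] at h0
  rw [a1, b1] at h1
  rw [a2, b2] at h2
  have hs3 : (0 : ℝ) < √3 := by positivity
  have hs23 : (0 : ℝ) < √(2 / 3) := by positivity
  have e2 : (n 2 : ℝ) = n' 2 := by nlinarith
  have e1 : (n 1 : ℝ) = n' 1 := by nlinarith
  have e0 : (n 0 : ℝ) = n' 0 := by linarith
  funext i
  fin_cases i
  · exact_mod_cast e0
  · exact_mod_cast e1
  · exact_mod_cast e2

/-- `latVec` is subtractive. [folklore] -/
theorem latVec_sub (n n' : Fin 3 → ℤ) : latVec (n - n') = latVec n - latVec n' := by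
  simp only [latVec, Pi.sub_apply, Int.cast_sub, sub_smul]
  abel

/-- The integer core of `dist(innerRef, Λ₀) ≥ 1`: `3(1 − 2d₀ − d₁)² + (1 − 3d₁)² + 8(1 − 2d₂)² ≥ 12`
(`1 − 2d₂` is odd; `1 − 3d₁ ≠ 0`, and `= ±1` only for `d₁ = 0`, where `1 − 2d₀` is odd). [folklore] -/
theorem twelve_le_core (d₀ d₁ d₂ : ℤ) :
    (12 : ℤ) ≤ 3 * (1 - 2 * d₀ - d₁) ^ 2 + (1 - 3 * d₁) ^ 2 + 8 * (1 - 2 * d₂) ^ 2 := by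
  have hc : 1 ≤ (1 - 2 * d₂) ^ 2 := by
    have h : (1 - 2 * d₂) ≠ 0 := by omega
    have : 0 < (1 - 2 * d₂) ^ 2 := by positivity
    linarith
  have hab : 4 ≤ 3 * (1 - 2 * d₀ - d₁) ^ 2 + (1 - 3 * d₁) ^ 2 := by
    rcases lt_trichotomy d₁ 0 with h | rfl | h
    · have hb : 2 ≤ 1 - 3 * d₁ := by linarith
      nlinarith [mul_le_mul hb hb (by norm_num) (by linarith), sq_nonneg (1 - 2 * d₀ - d₁)]
    · have h : (1 - 2 * d₀) ≠ 0 := by omega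
      have : 0 < (1 - 2 * d₀) ^ 2 := by positivity
      nlinarith
    · have hb : 2 ≤ 3 * d₁ - 1 := by linarith
      nlinarith [mul_le_mul hb hb (by norm_num) (by linarith), sq_nonneg (1 - 2 * d₀ - d₁)]
  linarith

/-- **The sublattices are `1` apart:** `‖innerRef − latVec d‖ ≥ 1` for every `d ∈ ℤ³`
(`dist(innerRef, Λ₀) = 1`, attained at the nearest neighbours). [folklore] -/
theorem one_le_norm_innerRef_sub_latVec (d : Fin 3 → ℤ) : 1 ≤ ‖innerRef - latVec d‖ := by
  obtain ⟨a0, a1, a2⟩ := latVec_apply d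
  obtain ⟨b0, b1, b2⟩ := innerRef_apply
  have h3 : (√3 : ℝ) ^ 2 = 3 := Real.sq_sqrt (by norm_num)
  have h23 : (√(2 / 3) : ℝ) ^ 2 = 2 / 3 := Real.sq_sqrt (by norm_num)
  have hsq : ‖innerRef - latVec d‖ ^ 2 =
      (3 * (1 - 2 * (d 0 : ℝ) - d 1) ^ 2 + (1 - 3 * (d 1 : ℝ)) ^ 2 + 8 * (1 - 2 * (d 2 : ℝ)) ^ 2) / 12 := by
    rw [EuclideanSpace.real_norm_sq_eq, Fin.sum_univ_three, PiLp.sub_apply, PiLp.sub_apply, PiLp.sub_apply,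
      a0, a1, a2, b0, b1, b2]
    linear_combination (1 / 6 - (d 1 : ℝ) / 2) ^ 2 * h3 + (1 - 2 * (d 2 : ℝ)) ^ 2 * h23
  have hcore : (12 : ℝ) ≤
      3 * (1 - 2 * (d 0 : ℝ) - d 1) ^ 2 + (1 - 3 * (d 1 : ℝ)) ^ 2 + 8 * (1 - 2 * (d 2 : ℝ)) ^ 2 := by
    exact_mod_cast twelve_le_core (d 0) (d 1) (d 2)
  have h1 : 1 ≤ ‖innerRef - latVec d‖ ^ 2 := by rw [hsq]; linarith
  nlinarith [norm_nonneg (innerRef - latVec d)]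

/-! ## The label map -/

/-- With `A (innerRef + δ) = t 1 − t 0` the label map reads `(m, n) ↦ t m + A·latVec n`. [folklore] -/
theorem siteMap_eq {t : Fin 2 → EuclideanSpace ℝ (Fin 3)}
    {A : EuclideanSpace ℝ (Fin 3) →L[ℝ] EuclideanSpace ℝ (Fin 3)} {δ : EuclideanSpace ℝ (Fin 3)}
    (hAδ : A (innerRef + δ) = t 1 - t 0) (m : Fin 2) (n : Fin 3 → ℤ) :
    siteMap t A δ (m, n) = t m + A (latVec n) := by
  fin_cases m
  · simp [siteMap, refPos]
  · simp only [siteMap, refPos, Fin.isValue, Fin.mk_one, if_true, map_add, hAδ]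
    abel

/-- The range of the label map is the site set `Sites₀ t A` (`Λ₀ = latVec ℤ³`). [folklore] -/
theorem range_siteMap {t : Fin 2 → EuclideanSpace ℝ (Fin 3)}
    {A : EuclideanSpace ℝ (Fin 3) →L[ℝ] EuclideanSpace ℝ (Fin 3)} {δ : EuclideanSpace ℝ (Fin 3)}
    (hAδ : A (innerRef + δ) = t 1 - t 0) : Set.range (siteMap t A δ) = Sites₀ t A := by
  ext p
  constructor
  · rintro ⟨⟨m, n⟩, rfl⟩
    rw [siteMap_eq hAδ]
    exact ⟨m, latVec n, ⟨n 0, n 1, n 2, rfl⟩, rfl⟩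
  · rintro ⟨m, z, ⟨i, j, k, rfl⟩, rfl⟩
    refine ⟨(m, ![i, j, k]), ?_⟩
    rw [siteMap_eq hAδ]
    simp [latVec, genU, genV, genC]

/-- The label map is injective: on each sublattice by injectivity of `A` and of `latVec`; across sublattices a
collision would put `innerRef + δ` in `latVec ℤ³`, contradicting `dist(innerRef, Λ₀) ≥ 1 > 5/189 ≥ ‖δ‖`.
[folklore] -/
theorem siteMap_injective {t : Fin 2 → EuclideanSpace ℝ (Fin 3)}
    {A : EuclideanSpace ℝ (Fin 3) →L[ℝ] EuclideanSpace ℝ (Fin 3)} {δ : EuclideanSpace ℝ (Fin 3)}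
    (hW : CellWindow A) (hδ : ShiftWindow A δ) (hAδ : A (innerRef + δ) = t 1 - t 0) :
    Function.Injective (siteMap t A δ) := by
  have hinj := injective_of_cellWindow hW
  have key1 : ∀ n n' : Fin 3 → ℤ, A (latVec n) = A (latVec n') → n = n' :=
    fun n n' h => latVec_injective (hinj h)
  have key2 : ∀ n n' : Fin 3 → ℤ, t 0 + A (latVec n) ≠ t 1 + A (latVec n') := by
    intro n n' h
    have h' : A (innerRef + δ) = A (latVec (n - n')) := by
      rw [hAδ, latVec_sub, map_sub]
      calc t 1 - t 0 = (t 1 + A (latVec n')) - A (latVec n') - t 0 := by abel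
        _ = (t 0 + A (latVec n)) - A (latVec n') - t 0 := by rw [h]
        _ = A (latVec n) - A (latVec n') := by abel
    have h'' : innerRef - latVec (n - n') = -δ := by
      have := hinj h'
      rw [← this]
      abel
    have h1 := one_le_norm_innerRef_sub_latVec (n - n')
    rw [h'', norm_neg] at h1
    have h2 := norm_shift_le hW hδ
    linarith
  rintro ⟨m, n⟩ ⟨m', n'⟩ h
  rw [siteMap_eq hAδ, siteMap_eq hAδ] at h
  fin_cases m <;> fin_cases m'
  · simp only [Fin.zero_eta, Fin.isValue, add_right_inj] at h
    rw [key1 n n' h]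
  · exact absurd h (by simpa using key2 n n')
  · exact absurd h.symm (by simpa using key2 n' n)
  · simp only [Fin.mk_one, Fin.isValue, add_right_inj] at h
    rw [key1 n n' h]

/-! ## The stub -/

/-- **S1a — LABEL MODEL** (`stub_labels`): an admissible datum `(t, A)` has the contragredient `B = A⁻ᵀ`
(adjoint of the inverse), the pulled-back shift error `δ = A⁻¹(t 1 − t 0) − innerRef` in the window, and the
label map `ℓ ↦ t 0 + A·refPos δ ℓ` is a bijection onto `Sites₀ t A`. [folklore] -/
theorem stub_labels : LabelModel := by
  intro t A hAdm hInn
  have hW : CellWindow A := cellWindow_of_adm₀ hAdm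
  obtain ⟨Ai, hA1, hA2⟩ := exists_inverse_of_cellWindow hW
  have hAδ : A (innerRef + (Ai (t 1 - t 0) - innerRef)) = t 1 - t 0 := by
    rw [add_sub_cancel, hA2]
  have hδ : ShiftWindow A (Ai (t 1 - t 0) - innerRef) := by
    show ‖A (Ai (t 1 - t 0) - innerRef)‖ ≤ 1 / 40
    rw [map_sub, hA2]
    exact hInn
  refine ⟨ContinuousLinearMap.adjoint Ai, Ai (t 1 - t 0) - innerRef, hW, hδ, ?_,
    siteMap_injective hW hδ hAδ, range_siteMap hAδ⟩
  intro x y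
  rw [ContinuousLinearMap.adjoint_inner_right, hA1]

end Summit.AtomisticToContinuum.Crystallization.Theorems.PhononStabilityCWC.LabelsStub

end
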